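/-
Copyright: the b2b-balaban T⁴-continuum CRUX team, row NE7b leaf-prover lineage `t4-ne7b-formalise-leaf-06` (gen 148). Project licence.
-/
import Mathlib.MeasureTheory.Measure.Haar.InnerProductSpace
import Mathlib.MeasureTheory.Integral.Prod
import Mathlib.Analysis.Convex.Strong
import Mathlib.MeasureTheory.Measure.Tilted

/-!
# THE BASE ∕ FIBRE SPLITTING OF A SOCKET's SINGLE EUCLIDEAN CARRIER — split charts `ℝ^{ι ⊕ κ} ≃ ℝ^ι × ℝ^κ` are measure-preserving and
# Pythagorean; the road's letters and windowed integrals transported from ONE carrier to the base × fibre product (row NE7b, node U5c)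

Cell `pub-balaban`, sub-cell `t4`, spine estimate NE7b (`T4WeightBudget.RelWeightBound`; the cell's OWN estimate — NOT PRINTED in [Bałaban 1983–89],
NOT PROVED).  Crux-route work under `Spine/NE7b/` by a LEAF of the row (FREEZE (0) crux-prover clause); NOTHING of Bałaban's is named or asserted;
no `T4Continuum/Support` leaf typed; no `def`; zero `sorry`.  Mathlib only (`EuclideanSpace.sumEquivProd` ∕ `finAddEquivProd`,
`PiLp.sumPiLpEquivProdLpPiLp`, `LinearIsometryEquiv.measurePreserving`, `WithLp.volume_preserving_ofLp`, `MeasurePreserving.setIntegral_preimage_emb`,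
`integral_prod` BY NAME).

WHY.  The sockets of the windowed convexity road (`…ConvexWindowTiltMoment`, `…ConvexWindowBrascampLieb`, …) live on ONE Euclidean carrier `EuclideanSpace ℝ (Fin N)`
(letter `V x + ⟪dV x, y − x⟫ + (λ∕2)‖y − x‖² ≤ V y` ON a convex window `K`), while the marginal step `…LogConcaveMarginal` (`V ↦ V⁺ = −log ∫_{K_x} e^{−V(x,·)}`
keeps the base modulus) and its companions live on the PRODUCT `EuclideanSpace ℝ (Fin m) × EuclideanSpace ℝ (Fin n)`; `…LogConcaveMarginal` lists «the base∕fibre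
splitting of a socket's single Euclidean carrier (a transport as in `…ConvexTiltMomentPi`)» as NOT THERE.  This file is that transport.  The product carries the SUP norm
in Mathlib (no inner product), so nothing is routed through `StrongConvexOn` on the product: every conclusion below is LITERALLY a hypothesis shape of
`…LogConcaveMarginal` §3 ∕ §4 ∕ §6 (resp. the output shape of `…ConvexityModulusTransport` §3 run ON THE CARRIER, which IS an inner product space).

WHAT IS PROVED ([folklore]):
* §1 SPLIT CHARTS `S : G ≃L[ℝ] X × Y` between real inner product spaces with the Pythagorean letter `‖z‖² = ‖(S z).1‖² + ‖(S z).2‖²`: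
  **`inner_eq_of_split`** (`⟪z, w⟫ = ⟪(S z).1, (S w).1⟫ + ⟪(S z).2, (S w).2⟫`, polarisation), `norm_sub_sq_of_split`.
* §2 LETTER TRANSPORT carrier → product window `S.symm ⁻¹' K` (= `S '' K`, Mathlib `ContinuousLinearEquiv.image_eq_preimage_symm`), exponent `V ∘ S.symm`:
  **`firstOrderOn_prod_of_split`** (the road's FIRST-ORDER letter ⟹ the two-partial-field letter with the product modulus — the hypothesis of
  `…LogConcaveMarginal.secant_base_of_firstOrderOn_prod`; the split inner product of §1 carries the field, nothing is lost (the converse holds the same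
  way) — contrast `…ConvexityModulusTransport.firstOrderOn_comp_clm_of_bound_below`, which needs an inner product on the target and pays `μ²`);
  in the SECANT currency **`secant_base_of_strongConvexOn_split`** (`StrongConvexOn K λ V`, `0 ≤ λ` ⟹ §3's `hVc` with the BASE share `‖q.1 − p.1‖²`),
  `convex_ineq_of_convexOn_split` (Prékopa's input) and **`secant_baseForm_of_split`** (a carrier letter with modulus `a·b·Q((S(y − x)).1)` IS §6's letter with
  `Q(q.1 − p.1)`) — HONEST OVERLAP: these three secant items are the special case `T := S.symm` of the OWNER's `…ConvexityModulusTransport` v3 §4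
  `secantForm_comp_linearMap` ∕ `secantForm_mono` (p373360, module-general, EXACT) closed with §1's Pythagorean letter; they are kept here, Mathlib-only, in
  `…LogConcaveMarginal`'s LITERAL hypothesis shapes so that the junction is `exact` (cert beside the twin); `convex_preimage_split`.
* §3 INTEGRAL TRANSPORT for a measure-preserving split chart of EUCLIDEAN spaces (`measurableSet_preimage_split`, `measurable_comp_split_symm`,
  `measurePreserving_split_symm`): `setIntegral_carrier_eq_split` (`∫_K F = ∫_{S.symm ⁻¹' K} F ∘ S.symm`),
  `integrableOn_split_iff`, **`setIntegral_prod_eq_integral_fibre`** (Fubini on a measurable product window: `∫_{K'} F = ∫ x, ∫_{K'_x} F(x,·)`),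
  **`setIntegral_carrier_eq_integral_fibre`**, `setIntegral_carrier_prodWindow` (`∫_{S ⁻¹'(B ×ˢ F)} Φ = ∫_B ∫_F Φ ∘ S.symm`; product windows are
  `S.symm ⁻¹' (S ⁻¹' K') = K'` by Mathlib's `ContinuousLinearEquiv.symm_preimage_preimage`), and **`setIntegral_carrier_baseObservable`**:
  `∫_K g((S z).1)·e^{−V z} dz = ∫ x, g x · (∫_{(S.symm ⁻¹' K)_x} e^{−V(S.symm(x,y))} dy) dx` — a BASE observable's windowed integral against `e^{−V}` on the
  carrier is the base integral of `g` against `…LogConcaveMarginal`'s fibre integral `x ↦ e^{−V⁺(x)}`.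
* §4 THE NAMED CHARTS SATISFY THE LETTERS: `EuclideanSpace.sumEquivProd` (`ℝ^{ι ⊕ κ}`; coordinates `z (inl i)` ∕ `z (inr k)`) and
  `EuclideanSpace.finAddEquivProd` (`ℝ^{m+n}`; coordinates `z (Fin.castAdd n i)` ∕ `z (Fin.natAdd m k)`) are measure-preserving and Pythagorean; any
  reindexing `e : α ≃ ι ⊕ κ` first (`LinearIsometryEquiv.piLpCongrLeft`).
* §5 THE WINDOWED TILT PUSHED TO THE BASE (product windows `K = S ⁻¹'(B ×ˢ F)`, Mathlib `Measure.tilted`): `setIntegral_prodWindow_baseObservable`,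
  `setIntegral_prodWindow_exp_neg` (`∫_K e^{−V} = ∫_B e^{−V⁺}`) and **`integral_windowTilted_baseObservable_eq`** — `∫ g((S z).1) dν_{V,K} = ∫ g dν_{V⁺,B}` with
  `V⁺(x) = −log ∫_F e^{−V(S.symm(x,y))} dy`: the sockets' windowed tilted means `m_k` of BASE functionals ARE tilted means under the marginal exponent at the
  next scale.  §6 a non-vacuity toy.
NOT HERE (honest): which coordinates of which of print's steps are kept ∕ integrated in which chart, the rescaling, the background dependence ((A3)∕(A1c), NC-NE7b-α
UNRULED); differentiability of `V⁺` (`…LogConcaveMarginalDeriv` ∕ `…FibreWindowSmooth`); anything of Bałaban's.  BY-NAME EFFECT ON THE WALL: NONE (bookkeeping of a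
chart).  NE7b NOT PRINTED ∕ NOT PROVED; spine PROVED 0∕9; rung (B)+1 on a FINITE torus — NOT infinite volume, NOT the mass gap, NOT Clay.
HONEST DEPENDENCY: continuum YM on T⁴ ⇐ BetaPertH ∧ nine spine estimates (0/9 proved); BetaPertH ⇐ (D1) ∧ (D4) ∧ CAP+tail. -/

set_option autoImplicit false

noncomputable section

open MeasureTheory Real Set
open scoped RealInnerProductSpace

namespace Summit.QuantumFields.BalabanUV.T4Continuum.NE7b.EuclideanCarrierSplit

/-! ## §1 Split charts: the Pythagorean letter splits the inner product -/

section Chart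

variable {G X Y : Type*} [NormedAddCommGroup G] [InnerProductSpace ℝ G] [NormedAddCommGroup X] [InnerProductSpace ℝ X]
  [NormedAddCommGroup Y] [InnerProductSpace ℝ Y] (S : G ≃L[ℝ] X × Y)

/-- **THE INNER PRODUCT SPLITS** along a split chart: if `‖z‖² = ‖(S z).1‖² + ‖(S z).2‖²` for all `z`, then
`⟪z, w⟫ = ⟪(S z).1, (S w).1⟫ + ⟪(S z).2, (S w).2⟫` (polarisation). [folklore] -/
theorem inner_eq_of_split (hSn : ∀ z, ‖z‖ ^ 2 = ‖(S z).1‖ ^ 2 + ‖(S z).2‖ ^ 2) (z w : G) :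
    ⟪z, w⟫ = ⟪(S z).1, (S w).1⟫ + ⟪(S z).2, (S w).2⟫ := by
  have h1 := norm_add_sq_real z w
  have h2 := norm_add_sq_real (S z).1 (S w).1
  have h3 := norm_add_sq_real (S z).2 (S w).2
  have h := hSn (z + w)
  rw [map_add, Prod.fst_add, Prod.snd_add] at h
  have hz := hSn z; have hw := hSn w
  linarith

/-- The squared distance splits: `‖y − x‖² = ‖(S y).1 − (S x).1‖² + ‖(S y).2 − (S x).2‖²`. [folklore] -/
theorem norm_sub_sq_of_split (hSn : ∀ z, ‖z‖ ^ 2 = ‖(S z).1‖ ^ 2 + ‖(S z).2‖ ^ 2) (x y : G) :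
    ‖y - x‖ ^ 2 = ‖(S y).1 - (S x).1‖ ^ 2 + ‖(S y).2 - (S x).2‖ ^ 2 := by
  rw [hSn (y - x), map_sub, Prod.fst_sub, Prod.snd_sub]

end Chart

/-! ## §2 Letter transport: ONE carrier ⟶ base × fibre (conclusions in `…LogConcaveMarginal`'s hypothesis shapes) -/

section Letters

variable {G X Y : Type*} [NormedAddCommGroup G] [InnerProductSpace ℝ G] [NormedAddCommGroup X] [InnerProductSpace ℝ X]
  [NormedAddCommGroup Y] [InnerProductSpace ℝ Y] (S : G ≃L[ℝ] X × Y)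

/-- A convex carrier window gives a convex product window. [folklore] -/
theorem convex_preimage_split {K : Set G} (hK : Convex ℝ K) : Convex ℝ (S.symm ⁻¹' K) :=
  hK.linear_preimage S.symm.toLinearEquiv.toLinearMap

/-- **THE ROAD's FIRST-ORDER LETTER ON THE CARRIER ⟹ THE TWO-PARTIAL-FIELD LETTER ON THE PRODUCT** (hypothesis of
`…LogConcaveMarginal.secant_base_of_firstOrderOn_prod`, for the exponent `V ∘ S.symm`, window `S.symm ⁻¹' K`, fields `(S (dV (S.symm p))).1 ∕ .2`):
`V x + ⟪dV x, y − x⟫ + (λ∕2)‖y − x‖² ≤ V y` ON `K` gives, for `p, q ∈ S.symm ⁻¹' K`,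
`V(S⁻¹p) + ⟪(S dV(S⁻¹p)).1, q.1 − p.1⟫ + ⟪(S dV(S⁻¹p)).2, q.2 − p.2⟫ + (λ∕2)(‖q.1 − p.1‖² + ‖q.2 − p.2‖²) ≤ V(S⁻¹q)`. [folklore] -/
theorem firstOrderOn_prod_of_split (hSn : ∀ z, ‖z‖ ^ 2 = ‖(S z).1‖ ^ 2 + ‖(S z).2‖ ^ 2) {K : Set G} {V : G → ℝ} {dV : G → G} {lam : ℝ}
    (h : ∀ x ∈ K, ∀ y ∈ K, V x + ⟪dV x, y - x⟫ + lam / 2 * ‖y - x‖ ^ 2 ≤ V y) :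
    ∀ p ∈ S.symm ⁻¹' K, ∀ q ∈ S.symm ⁻¹' K,
      V (S.symm p) + ⟪(S (dV (S.symm p))).1, q.1 - p.1⟫ + ⟪(S (dV (S.symm p))).2, q.2 - p.2⟫ +
        lam / 2 * (‖q.1 - p.1‖ ^ 2 + ‖q.2 - p.2‖ ^ 2) ≤ V (S.symm q) := by
  intro p hp q hq
  have key := h _ hp _ hq
  rw [inner_eq_of_split S hSn, norm_sub_sq_of_split S hSn, map_sub, S.apply_symm_apply, S.apply_symm_apply,
    Prod.fst_sub, Prod.snd_sub] at key
  linarith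

/-- **STRONG CONVEXITY ON THE CARRIER ⟹ THE BASE-SHARE SECANT LETTER ON THE PRODUCT** (hypothesis `hVc` of
`…LogConcaveMarginal.strongConvexOn_neg_log_fibreIntegral` for `V ∘ S.symm` on `S.symm ⁻¹' K`): `StrongConvexOn K λ V` with `0 ≤ λ` gives
`V(S⁻¹(a p + b q)) + (λ∕2)·a·b·‖q.1 − p.1‖² ≤ a V(S⁻¹p) + b V(S⁻¹q)` — the fibre share `‖q.2 − p.2‖²` of the modulus is discarded (by value: the refuter's
κ-ne7bref-g77-1).  (= `…ConvexityModulusTransport` v3 §4 `secantForm_comp_linearMap` at `T := S.symm` + `secantForm_mono` + §1; stated end-to-end in the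
literal shape.) [folklore] -/
theorem secant_base_of_strongConvexOn_split (hSn : ∀ z, ‖z‖ ^ 2 = ‖(S z).1‖ ^ 2 + ‖(S z).2‖ ^ 2) {K : Set G} {V : G → ℝ} {lam : ℝ}
    (hlam : 0 ≤ lam) (hV : StrongConvexOn K lam V) :
    ∀ p ∈ S.symm ⁻¹' K, ∀ q ∈ S.symm ⁻¹' K, ∀ a b : ℝ, 0 ≤ a → 0 ≤ b → a + b = 1 →
      V (S.symm (a • p + b • q)) + lam / 2 * a * b * ‖q.1 - p.1‖ ^ 2 ≤ a * V (S.symm p) + b * V (S.symm q) := by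
  intro p hp q hq a b ha hb hab
  have key := hV.2 hp hq ha hb hab
  simp only [smul_eq_mul] at key
  have hsplit := norm_sub_sq_of_split S hSn (S.symm q) (S.symm p)
  rw [S.apply_symm_apply, S.apply_symm_apply] at hsplit
  have hnn : 0 ≤ lam / 2 * a * b * ‖p.2 - q.2‖ ^ 2 := by positivity
  rw [hsplit, show a * b * (lam / 2 * (‖p.1 - q.1‖ ^ 2 + ‖p.2 - q.2‖ ^ 2)) =
    lam / 2 * a * b * ‖p.1 - q.1‖ ^ 2 + lam / 2 * a * b * ‖p.2 - q.2‖ ^ 2 by ring] at key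
  rw [map_add, map_smul, map_smul, norm_sub_rev q.1 p.1]
  linarith

/-- **CONVEXITY ON THE CARRIER ⟹ THE CONVEXITY INEQUALITY ON THE PRODUCT** (hypothesis `hVc` of `…LogConcaveMarginal.convexOn_neg_log_fibreIntegral`,
Prékopa's input). [folklore] -/
theorem convex_ineq_of_convexOn_split {K : Set G} {V : G → ℝ} (hV : ConvexOn ℝ K V) :
    ∀ p ∈ S.symm ⁻¹' K, ∀ q ∈ S.symm ⁻¹' K, ∀ a b : ℝ, 0 ≤ a → 0 ≤ b → a + b = 1 →
      V (S.symm (a • p + b • q)) ≤ a * V (S.symm p) + b * V (S.symm q) := by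
  intro p hp q hq a b ha hb hab
  have key := (hV.comp_linearMap S.symm.toLinearEquiv.toLinearMap).2 hp hq ha hb hab
  simpa [smul_eq_mul] using key

/-- **A BASE-FORM MODULUS READ THROUGH THE CHART IS `…LogConcaveMarginal` §6's LETTER**: the carrier secant letter
`V(a x + b y) + a·b·Q((S(y − x)).1) ≤ a V x + b V y` ON `K` (for instance the output of `…ConvexityModulusTransport.secant_of_firstOrderOn_form` run ON THE
CARRIER — an inner product space — with the 2-homogeneous form `v ↦ Q((S v).1)`) gives `V(S⁻¹(a p + b q)) + a·b·Q(q.1 − p.1) ≤ a V(S⁻¹p) + b V(S⁻¹q)` on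
`S.symm ⁻¹' K` (= `…ConvexityModulusTransport` v3 `secantForm_comp_linearMap` at `T := S.symm`, form `(Q ∘ Prod.fst ∘ S) ∘ S.symm = Q ∘ Prod.fst`). [folklore] -/
theorem secant_baseForm_of_split {K : Set G} {V : G → ℝ} (Q : X → ℝ)
    (h : ∀ x ∈ K, ∀ y ∈ K, ∀ a b : ℝ, 0 ≤ a → 0 ≤ b → a + b = 1 → V (a • x + b • y) + a * b * Q ((S (y - x)).1) ≤ a * V x + b * V y) :
    ∀ p ∈ S.symm ⁻¹' K, ∀ q ∈ S.symm ⁻¹' K, ∀ a b : ℝ, 0 ≤ a → 0 ≤ b → a + b = 1 →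
      V (S.symm (a • p + b • q)) + a * b * Q (q.1 - p.1) ≤ a * V (S.symm p) + b * V (S.symm q) := by
  intro p hp q hq a b ha hb hab
  have key := h _ hp _ hq a b ha hb hab
  rwa [map_sub, S.apply_symm_apply, S.apply_symm_apply, Prod.fst_sub, ← map_smul, ← map_smul, ← map_add] at key

end Letters

/-! ## §3 Integral transport for a measure-preserving split chart of Euclidean spaces -/

section Integrals

variable {α ι κ : Type*} [Fintype α] [Fintype ι] [Fintype κ]
  (S : EuclideanSpace ℝ α ≃L[ℝ] EuclideanSpace ℝ ι × EuclideanSpace ℝ κ)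

/-- A measurable carrier window gives a measurable product window. [folklore] -/
theorem measurableSet_preimage_split {K : Set (EuclideanSpace ℝ α)} (hK : MeasurableSet K) : MeasurableSet (S.symm ⁻¹' K) :=
  hK.preimage S.symm.continuous.measurable

/-- A measurable carrier exponent gives a measurable product exponent `V ∘ S.symm`. [folklore] -/
theorem measurable_comp_split_symm {V : EuclideanSpace ℝ α → ℝ} (hV : Measurable V) : Measurable fun p => V (S.symm p) :=
  hV.comp S.symm.continuous.measurable

/-- A split chart is a measurable embedding. [folklore] -/
theorem measurableEmbedding_split : MeasurableEmbedding S := S.toHomeomorph.measurableEmbedding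

/-- The inverse chart is measure-preserving too. [folklore] -/
theorem measurePreserving_split_symm (hS : MeasurePreserving S volume volume) : MeasurePreserving S.symm volume volume :=
  MeasurePreserving.symm S.toHomeomorph.toMeasurableEquiv hS

/-- **CHANGE OF VARIABLES ON A WINDOW**: `∫_K F = ∫_{S.symm ⁻¹' K} F ∘ S.symm` (carrier volume ↔ product volume). [folklore] -/
theorem setIntegral_carrier_eq_split (hS : MeasurePreserving S volume volume) {E : Type*} [NormedAddCommGroup E] [NormedSpace ℝ E]
    (F : EuclideanSpace ℝ α → E) (K : Set (EuclideanSpace ℝ α)) :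
    ∫ z in K, F z = ∫ p in S.symm ⁻¹' K, F (S.symm p) :=
  ((measurePreserving_split_symm S hS).setIntegral_preimage_emb S.symm.toHomeomorph.measurableEmbedding F K).symm

/-- Integrability transports: `F ∘ S.symm` is integrable on `S.symm ⁻¹' K` iff `F` is integrable on `K`. [folklore] -/
theorem integrableOn_split_iff (hS : MeasurePreserving S volume volume) {E : Type*} [NormedAddCommGroup E]
    (F : EuclideanSpace ℝ α → E) (K : Set (EuclideanSpace ℝ α)) :
    IntegrableOn (fun p => F (S.symm p)) (S.symm ⁻¹' K) ↔ IntegrableOn F K :=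
  (measurePreserving_split_symm S hS).integrableOn_comp_preimage S.symm.toHomeomorph.measurableEmbedding

/-- **FUBINI ON A MEASURABLE PRODUCT WINDOW**: for `F` integrable on `K' ⊆ ℝ^ι × ℝ^κ`, `∫_{K'} F = ∫ x, ∫_{K'_x} F(x, y) dy dx` with the fibres
`K'_x = Prod.mk x ⁻¹' K'` of `…LogConcaveMarginal`. [folklore] -/
theorem setIntegral_prod_eq_integral_fibre {E : Type*} [NormedAddCommGroup E] [NormedSpace ℝ E]
    {K' : Set (EuclideanSpace ℝ ι × EuclideanSpace ℝ κ)} (hK' : MeasurableSet K') {F : EuclideanSpace ℝ ι × EuclideanSpace ℝ κ → E}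
    (hF : IntegrableOn F K') :
    ∫ p in K', F p = ∫ x, ∫ y in Prod.mk x ⁻¹' K', F (x, y) := by
  rw [← integral_indicator hK', Measure.volume_eq_prod, integral_prod _ (hF.integrable_indicator hK')]
  refine integral_congr_ae (Filter.Eventually.of_forall fun x => ?_)
  dsimp only
  rw [← integral_indicator (hK'.preimage measurable_prodMk_left)]
  rfl

/-- **THE CARRIER's WINDOWED INTEGRAL IS A BASE INTEGRAL OF FIBRE INTEGRALS**: `∫_K F = ∫ x, ∫_{(S.symm ⁻¹' K)_x} F(S.symm(x, y)) dy dx` for `F`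
integrable on a measurable window `K`. [folklore] -/
theorem setIntegral_carrier_eq_integral_fibre (hS : MeasurePreserving S volume volume) {E : Type*} [NormedAddCommGroup E] [NormedSpace ℝ E]
    {K : Set (EuclideanSpace ℝ α)} (hK : MeasurableSet K) {F : EuclideanSpace ℝ α → E} (hF : IntegrableOn F K) :
    ∫ z in K, F z = ∫ x, ∫ y in Prod.mk x ⁻¹' (S.symm ⁻¹' K), F (S.symm (x, y)) := by
  rw [setIntegral_carrier_eq_split S hS F K,
    setIntegral_prod_eq_integral_fibre (hK.preimage S.symm.continuous.measurable) ((integrableOn_split_iff S hS F K).2 hF)]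

/-- **THE JUNCTION IDENTITY**: for a BASE observable `g` and an exponent `V` with `g((S z).1)·e^{−V z}` integrable on the measurable window `K`,
`∫_K g((S z).1)·e^{−V z} dz = ∫ x, g x · (∫_{(S.symm ⁻¹' K)_x} e^{−V(S.symm(x, y))} dy) dx` — the carrier's windowed tilted integral of `g ∘ fst ∘ S` is the
base integral of `g` against `…LogConcaveMarginal`'s fibre integral `x ↦ ∫_{K'_x} e^{−(V ∘ S.symm)(x,·)} = e^{−V⁺(x)}`. [folklore] -/
theorem setIntegral_carrier_baseObservable (hS : MeasurePreserving S volume volume) {K : Set (EuclideanSpace ℝ α)} (hK : MeasurableSet K)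
    (g : EuclideanSpace ℝ ι → ℝ) (V : EuclideanSpace ℝ α → ℝ) (hI : IntegrableOn (fun z => g (S z).1 * exp (-V z)) K) :
    ∫ z in K, g (S z).1 * exp (-V z) = ∫ x, g x * ∫ y in Prod.mk x ⁻¹' (S.symm ⁻¹' K), exp (-V (S.symm (x, y))) := by
  rw [setIntegral_carrier_eq_integral_fibre S hS hK hI]
  refine integral_congr_ae (Filter.Eventually.of_forall fun x => ?_)
  simp only [ContinuousLinearEquiv.apply_symm_apply]
  exact integral_const_mul _ _

/-- **PRODUCT WINDOWS** (the setting of `…LogConcaveMarginalDeriv` §4 ∕ `…FibreWindowSmooth`): for the carrier window `S ⁻¹' (B ×ˢ F)` cut out by a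
base window `B` and a fluctuation window `F`, `∫_{S ⁻¹' (B ×ˢ F)} Φ = ∫_{x ∈ B} ∫_{y ∈ F} Φ(S.symm(x, y)) dy dx`. [folklore] -/
theorem setIntegral_carrier_prodWindow (hS : MeasurePreserving S volume volume) {E : Type*} [NormedAddCommGroup E] [NormedSpace ℝ E]
    (B : Set (EuclideanSpace ℝ ι)) (F : Set (EuclideanSpace ℝ κ)) {Φ : EuclideanSpace ℝ α → E} (hΦ : IntegrableOn Φ (S ⁻¹' (B ×ˢ F))) :
    ∫ z in S ⁻¹' (B ×ˢ F), Φ z = ∫ x in B, ∫ y in F, Φ (S.symm (x, y)) := by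
  rw [setIntegral_carrier_eq_split S hS Φ, S.symm_preimage_preimage, Measure.volume_eq_prod, setIntegral_prod]
  rw [← Measure.volume_eq_prod, ← S.symm_preimage_preimage (B ×ˢ F)]
  exact (integrableOn_split_iff S hS Φ _).2 hΦ

end Integrals

/-! ## §4 The named charts of Mathlib satisfy both letters -/

section Named

variable {α ι κ : Type*} [Fintype α] [Fintype ι] [Fintype κ]

/-- `EuclideanSpace.sumEquivProd : ℝ^{ι ⊕ κ} ≃L ℝ^ι × ℝ^κ` keeps the `inl`-coordinates in the base and the `inr`-coordinates in the fibre. [folklore] -/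
theorem sumEquivProd_apply (z : EuclideanSpace ℝ (ι ⊕ κ)) (i : ι) (k : κ) :
    (EuclideanSpace.sumEquivProd (𝕜 := ℝ) z).1 i = z (Sum.inl i) ∧ (EuclideanSpace.sumEquivProd (𝕜 := ℝ) z).2 k = z (Sum.inr k) := by
  constructor <;> simp [EuclideanSpace.sumEquivProd]

/-- `sumEquivProd` is, pointwise, the linear isometry `PiLp.sumPiLpEquivProdLpPiLp` onto `WithLp 2 (ℝ^ι × ℝ^κ)` followed by `WithLp.ofLp`. [folklore] -/
theorem sumEquivProd_eq_ofLp (z : EuclideanSpace ℝ (ι ⊕ κ)) :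
    EuclideanSpace.sumEquivProd (𝕜 := ℝ) z = WithLp.ofLp (PiLp.sumPiLpEquivProdLpPiLp 2 (fun _ : ι ⊕ κ => ℝ) (𝕜 := ℝ) z) := rfl

/-- **`sumEquivProd` IS PYTHAGOREAN**: `‖z‖² = ‖(S z).1‖² + ‖(S z).2‖²`. [folklore] -/
theorem norm_sq_sumEquivProd (z : EuclideanSpace ℝ (ι ⊕ κ)) :
    ‖z‖ ^ 2 = ‖(EuclideanSpace.sumEquivProd (𝕜 := ℝ) z).1‖ ^ 2 + ‖(EuclideanSpace.sumEquivProd (𝕜 := ℝ) z).2‖ ^ 2 := by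
  rw [← (PiLp.sumPiLpEquivProdLpPiLp 2 (fun _ : ι ⊕ κ => ℝ) (𝕜 := ℝ)).norm_map z, sumEquivProd_eq_ofLp]
  exact WithLp.prod_norm_sq_eq_of_L2 _

/-- **`sumEquivProd` IS MEASURE-PRESERVING** (carrier volume → product volume): a linear isometry onto `WithLp 2 (ℝ^ι × ℝ^κ)` followed by
Mathlib's `WithLp.volume_preserving_ofLp`. [folklore] -/
theorem measurePreserving_sumEquivProd :
    MeasurePreserving (EuclideanSpace.sumEquivProd (𝕜 := ℝ) (ι := ι) (κ := κ)) volume volume := by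
  have h := (WithLp.volume_preserving_ofLp (EuclideanSpace ℝ ι) (EuclideanSpace ℝ κ)).comp
    (PiLp.sumPiLpEquivProdLpPiLp 2 (fun _ : ι ⊕ κ => ℝ) (𝕜 := ℝ)).measurePreserving
  have e : (EuclideanSpace.sumEquivProd (𝕜 := ℝ) : EuclideanSpace ℝ (ι ⊕ κ) → EuclideanSpace ℝ ι × EuclideanSpace ℝ κ) =
      WithLp.ofLp ∘ (PiLp.sumPiLpEquivProdLpPiLp 2 (fun _ : ι ⊕ κ => ℝ) (𝕜 := ℝ)) := funext (sumEquivProd_eq_ofLp)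
  rw [e]
  exact h

/-- **ANY REINDEXING FIRST**: for `e : α ≃ ι ⊕ κ` (which coordinates of the carrier `ℝ^α` are kept ∕ integrated), the chart
`piLpCongrLeft e ≫ sumEquivProd` is measure-preserving … [folklore] -/
theorem measurePreserving_reindex_sumEquivProd (e : α ≃ ι ⊕ κ) :
    MeasurePreserving ((LinearIsometryEquiv.piLpCongrLeft 2 ℝ ℝ e).toContinuousLinearEquiv.trans
      (EuclideanSpace.sumEquivProd (𝕜 := ℝ) (ι := ι) (κ := κ))) volume volume :=
  (measurePreserving_sumEquivProd (ι := ι) (κ := κ)).comp (LinearIsometryEquiv.piLpCongrLeft 2 ℝ ℝ e).measurePreserving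

/-- … Pythagorean … [folklore] -/
theorem norm_sq_reindex_sumEquivProd (e : α ≃ ι ⊕ κ) (z : EuclideanSpace ℝ α) :
    ‖z‖ ^ 2 = ‖(((LinearIsometryEquiv.piLpCongrLeft 2 ℝ ℝ e).toContinuousLinearEquiv.trans
        (EuclideanSpace.sumEquivProd (𝕜 := ℝ) (ι := ι) (κ := κ))) z).1‖ ^ 2 +
      ‖(((LinearIsometryEquiv.piLpCongrLeft 2 ℝ ℝ e).toContinuousLinearEquiv.trans
        (EuclideanSpace.sumEquivProd (𝕜 := ℝ) (ι := ι) (κ := κ))) z).2‖ ^ 2 := by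
  rw [ContinuousLinearEquiv.trans_apply, ← norm_sq_sumEquivProd]
  exact congrArg (· ^ 2) ((LinearIsometryEquiv.piLpCongrLeft 2 ℝ ℝ e).norm_map z).symm

/-- … with base coordinates `z (e.symm (inl i))` and fibre coordinates `z (e.symm (inr k))`. [folklore] -/
theorem reindex_sumEquivProd_apply (e : α ≃ ι ⊕ κ) (z : EuclideanSpace ℝ α) (i : ι) (k : κ) :
    (((LinearIsometryEquiv.piLpCongrLeft 2 ℝ ℝ e).toContinuousLinearEquiv.trans
        (EuclideanSpace.sumEquivProd (𝕜 := ℝ) (ι := ι) (κ := κ))) z).1 i = z (e.symm (Sum.inl i)) ∧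
      (((LinearIsometryEquiv.piLpCongrLeft 2 ℝ ℝ e).toContinuousLinearEquiv.trans
        (EuclideanSpace.sumEquivProd (𝕜 := ℝ) (ι := ι) (κ := κ))) z).2 k = z (e.symm (Sum.inr k)) := by
  constructor <;>
    simp [EuclideanSpace.sumEquivProd, LinearIsometryEquiv.piLpCongrLeft_apply, Equiv.piCongrLeft'_apply]

/-- **`finAddEquivProd : ℝ^{m+n} ≃L ℝ^m × ℝ^n`** (the first `m` coordinates kept, the last `n` integrated) is measure-preserving, … [folklore] -/
theorem measurePreserving_finAddEquivProd (m n : ℕ) :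
    MeasurePreserving (EuclideanSpace.finAddEquivProd (𝕜 := ℝ) (n := m) (m := n)) volume volume :=
  measurePreserving_reindex_sumEquivProd finSumFinEquiv.symm

/-- … Pythagorean, … [folklore] -/
theorem norm_sq_finAddEquivProd (m n : ℕ) (z : EuclideanSpace ℝ (Fin (m + n))) :
    ‖z‖ ^ 2 = ‖(EuclideanSpace.finAddEquivProd (𝕜 := ℝ) (n := m) (m := n) z).1‖ ^ 2 +
      ‖(EuclideanSpace.finAddEquivProd (𝕜 := ℝ) (n := m) (m := n) z).2‖ ^ 2 :=
  norm_sq_reindex_sumEquivProd finSumFinEquiv.symm z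

/-- … with base coordinates `z (Fin.castAdd n i)` and fibre coordinates `z (Fin.natAdd m k)`. [folklore] -/
theorem finAddEquivProd_apply (m n : ℕ) (z : EuclideanSpace ℝ (Fin (m + n))) (i : Fin m) (k : Fin n) :
    (EuclideanSpace.finAddEquivProd (𝕜 := ℝ) (n := m) (m := n) z).1 i = z (Fin.castAdd n i) ∧
      (EuclideanSpace.finAddEquivProd (𝕜 := ℝ) (n := m) (m := n) z).2 k = z (Fin.natAdd m k) := by
  constructor <;>
    simp [EuclideanSpace.finAddEquivProd, EuclideanSpace.sumEquivProd, LinearIsometryEquiv.piLpCongrLeft_apply]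

end Named

/-! ## §5 The windowed TILTED measure of the carrier, pushed to the base: tilted means of base observables are tilted means under the marginal exponent -/

section Tilted

variable {α ι κ : Type*} [Fintype α] [Fintype ι] [Fintype κ]
  (S : EuclideanSpace ℝ α ≃L[ℝ] EuclideanSpace ℝ ι × EuclideanSpace ℝ κ)

/-- Product window, numerator: `∫_{S ⁻¹'(B ×ˢ F)} g((S z).1)·e^{−V z} dz = ∫_B g x · (∫_F e^{−V(S.symm(x,y))} dy) dx`. [folklore] -/
theorem setIntegral_prodWindow_baseObservable (hS : MeasurePreserving S volume volume) (B : Set (EuclideanSpace ℝ ι))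
    (F : Set (EuclideanSpace ℝ κ)) (g : EuclideanSpace ℝ ι → ℝ) (V : EuclideanSpace ℝ α → ℝ)
    (hI : IntegrableOn (fun z => g (S z).1 * exp (-V z)) (S ⁻¹' (B ×ˢ F))) :
    ∫ z in S ⁻¹' (B ×ˢ F), g (S z).1 * exp (-V z) = ∫ x in B, g x * ∫ y in F, exp (-V (S.symm (x, y))) := by
  rw [setIntegral_carrier_prodWindow S hS B F hI]
  refine integral_congr_ae (Filter.Eventually.of_forall fun x => ?_)
  dsimp only
  simp only [ContinuousLinearEquiv.apply_symm_apply]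
  exact integral_const_mul _ _

/-- Product window, partition function: `∫_{S ⁻¹'(B ×ˢ F)} e^{−V} = ∫_B (∫_F e^{−V(S.symm(x,y))} dy) dx`. [folklore] -/
theorem setIntegral_prodWindow_exp_neg (hS : MeasurePreserving S volume volume) (B : Set (EuclideanSpace ℝ ι))
    (F : Set (EuclideanSpace ℝ κ)) (V : EuclideanSpace ℝ α → ℝ) (hZ : IntegrableOn (fun z => exp (-V z)) (S ⁻¹' (B ×ˢ F))) :
    ∫ z in S ⁻¹' (B ×ˢ F), exp (-V z) = ∫ x in B, ∫ y in F, exp (-V (S.symm (x, y))) := by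
  have h := setIntegral_prodWindow_baseObservable S hS B F (fun _ => 1) V (by simpa using hZ)
  simpa using h

/-- **THE WINDOWED TILT PUSHED TO THE BASE.**  For the product window `K = S ⁻¹'(B ×ˢ F)` (`B` measurable) and the marginal exponent
`V⁺(x) = −log ∫_F e^{−V(S.symm(x,y))} dy`, positive fibre integrals on `B`: the `ν_{V,K}`-mean of a BASE observable `g((S z).1)` equals the
`ν_{V⁺,B}`-mean of `g` — `∫ g((S z).1) dν_{V,K}(z) = ∫ g dν_{V⁺,B}`, `ν_{V,K} = 1_K e^{−V} dz ∕ ∫_K e^{−V}`, `ν_{V⁺,B} = 1_B e^{−V⁺} dx ∕ ∫_B e^{−V⁺}`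
(Mathlib `Measure.tilted`).  This is the letter an instance needs to read the sockets' windowed tilted means `m_k = ∫⟪u_k, ·⟫ dν_{V,K}` of BASE
functionals at the next scale. [folklore] -/
theorem integral_windowTilted_baseObservable_eq (hS : MeasurePreserving S volume volume) {B : Set (EuclideanSpace ℝ ι)} (hB : MeasurableSet B)
    (F : Set (EuclideanSpace ℝ κ)) (g : EuclideanSpace ℝ ι → ℝ) (V : EuclideanSpace ℝ α → ℝ)
    (hpos : ∀ x ∈ B, 0 < ∫ y in F, exp (-V (S.symm (x, y))))
    (hI : IntegrableOn (fun z => g (S z).1 * exp (-V z)) (S ⁻¹' (B ×ˢ F))) (hZ : IntegrableOn (fun z => exp (-V z)) (S ⁻¹' (B ×ˢ F))) :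
    ∫ z, g (S z).1 ∂((volume.restrict (S ⁻¹' (B ×ˢ F))).tilted fun z => -V z) =
      ∫ x, g x ∂((volume.restrict B).tilted fun x => -(-log (∫ y in F, exp (-V (S.symm (x, y)))))) := by
  rw [integral_tilted, integral_tilted]
  -- the base density `e^{−V⁺}` IS the fibre integral on `B`
  have hdens : ∀ x ∈ B, exp (-(-log (∫ y in F, exp (-V (S.symm (x, y)))))) = ∫ y in F, exp (-V (S.symm (x, y))) := by
    intro x hx
    rw [neg_neg, exp_log (hpos x hx)]
  have hZeq : ∫ x in B, exp (-(-log (∫ y in F, exp (-V (S.symm (x, y)))))) = ∫ z in S ⁻¹' (B ×ˢ F), exp (-V z) := by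
    rw [setIntegral_prodWindow_exp_neg S hS B F V hZ]
    exact setIntegral_congr_fun hB hdens
  rw [hZeq]
  set Z := ∫ z in S ⁻¹' (B ×ˢ F), exp (-V z) with hZdef
  have hL : ∫ z in S ⁻¹' (B ×ˢ F), (exp (-V z) / Z) • g (S z).1 = Z⁻¹ * ∫ z in S ⁻¹' (B ×ˢ F), g (S z).1 * exp (-V z) := by
    rw [← integral_const_mul]
    refine integral_congr_ae (Filter.Eventually.of_forall fun z => ?_)
    simp only [smul_eq_mul]
    ring
  have hR : ∫ x in B, (exp (-(-log (∫ y in F, exp (-V (S.symm (x, y)))))) / Z) • g x =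
      Z⁻¹ * ∫ x in B, g x * ∫ y in F, exp (-V (S.symm (x, y))) := by
    rw [← integral_const_mul]
    refine setIntegral_congr_fun hB fun x hx => ?_
    simp only [smul_eq_mul]
    rw [hdens x hx]
    ring
  rw [hL, hR, setIntegral_prodWindow_baseObservable S hS B F g V hI]

end Tilted

/-! ## §6 Non-vacuity: the letters transported for the standard Gaussian exponent on `ℝ^{m+n}` -/

/-- Toy: `V = ½‖z‖²` (λ = 1) on `ℝ^{m+n}` — the carrier letter holds, so §2's product letter for `finAddEquivProd` is inhabited. -/
example (m n : ℕ) :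
    (∀ p ∈ (EuclideanSpace.finAddEquivProd (𝕜 := ℝ) (n := m) (m := n)).symm ⁻¹' univ,
      ∀ q ∈ (EuclideanSpace.finAddEquivProd (𝕜 := ℝ) (n := m) (m := n)).symm ⁻¹' univ, ∀ a b : ℝ, 0 ≤ a → 0 ≤ b → a + b = 1 →
        (fun z : EuclideanSpace ℝ (Fin (m + n)) => 1 / 2 * ‖z‖ ^ 2) ((EuclideanSpace.finAddEquivProd (𝕜 := ℝ)).symm (a • p + b • q)) +
          1 / 2 * a * b * ‖q.1 - p.1‖ ^ 2 ≤
        a * (fun z : EuclideanSpace ℝ (Fin (m + n)) => 1 / 2 * ‖z‖ ^ 2) ((EuclideanSpace.finAddEquivProd (𝕜 := ℝ)).symm p) +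
          b * (fun z : EuclideanSpace ℝ (Fin (m + n)) => 1 / 2 * ‖z‖ ^ 2) ((EuclideanSpace.finAddEquivProd (𝕜 := ℝ)).symm q)) := by
  refine secant_base_of_strongConvexOn_split (K := univ) (V := fun z : EuclideanSpace ℝ (Fin (m + n)) => 1 / 2 * ‖z‖ ^ 2) _
    (norm_sq_finAddEquivProd m n) zero_le_one ?_
  refine ⟨convex_univ, fun x _ y _ a b ha hb hab => ?_⟩
  have h := norm_add_sq_real (a • x) (b • y)
  rw [norm_smul, norm_smul, Real.norm_eq_abs, Real.norm_eq_abs, abs_of_nonneg ha, abs_of_nonneg hb, inner_smul_left, inner_smul_right] at h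
  have h2 := norm_sub_sq_real x y
  simp only [smul_eq_mul, conj_trivial] at h ⊢
  have hab' : b = 1 - a := by linarith
  subst hab'; nlinarith [h, h2, real_inner_le_norm x y, norm_nonneg x, norm_nonneg y, mul_nonneg ha hb]

end Summit.QuantumFields.BalabanUV.T4Continuum.NE7b.EuclideanCarrierSplit

end
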